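import Literature.Topology.FourManifolds.FishtailTubeInj
import HarnessLib

/-!
# The tube about Gompf's disc at general offsets: a taxonomy of its points

Infrastructure for the explicit fishtail neighbourhood (R. Gompf, *More Cappell–Shaneson spheres
are standard*, Algebr. Geom. Topol. 10 (2010), proof of Thm 2.1 and Lemma 2.2; the named fact
`Literature.Topology.FourManifolds.gompf2010_framedTwist`). Every point of the tube
`tubeD (ζ, w)` (`w` in the annulus of admissible offsets, `‖ζ‖ < c r_h` = the hole region of the
end map) is of one of four kinds (`FP.hole_taxonomy`):

* `NewPt` — a point of the new piece `D² × S²` (near the two cap centres);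
* `YSmall` — an old point whose fibre coordinate `z₂ = e^{iy}` has `|y| ≤ 1/2` (the part over `D⁰`,
  the collar annulus and the wall);
* `U3Pt` — an old point `[x, t]`, `t < 7/8`, with `z₂ = e^{iy}`, `0 ≤ y ≤ 5/2` (the vertical segment);
* `TLow` — an old point `[x, t]` with `t < t_H = 1 - h · 396/10000` (the planar path and the leg).

These separate the hole piece of the end map from its box shell (`t ≥ 1 + e h`, `y ∈ (1, 6)`) and
its bent corner (`t > 1 - h c p₁ = 249/250`, `y ≈ y_h`).

Everything is proved; no named facts.

## References

* R. E. Gompf, *More Cappell–Shaneson spheres are standard*, Algebr. Geom. Topol. 10 (2010)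
  1665–1681, proof of Thm 2.1 and Lemma 2.2. [GompfAGT2010]
-/

noncomputable section

open scoped Real Topology ContDiff Manifold
open Set Filter Complex Metric

namespace Literature.Topology.FourManifolds

local notation "𝔼 " n:arg => EuclideanSpace ℝ (Fin n)

namespace FP

variable {ε : ℝ} (hε : 0 < ε) (hε2 : ε ≤ 1 / 2)

/-! ### The four kinds of points -/

/-- A point of the new piece. [folklore] -/
def NewPt (p : (fishNu hε hε2).Surgered) : Prop := ∃ b, p = (fishNu hε hε2).glueData.inr b

/-- An old point with small fibre angle. [folklore] -/
def YSmall (p : (fishNu hε hε2).Surgered) : Prop :=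
  ∃ (m : MTorus tubeShearDiffeo) (y : ℝ), p = toSurg (fishNu hε hε2) m ∧ yC m = Circle.exp y ∧ |y| ≤ 1 / 2

/-- The leg threshold `t_H = 1 - h · 396/10000`. [folklore] -/
def tH : ℝ := 1 - bxH * (396 / 10000)

/-- `tH = 99208 / 100000`. [folklore] -/
theorem tH_eq : tH = 99208 / 100000 := by rw [tH, bxH]; norm_num

/-- An old point `[x, t]` with `1/2 < t < t_H`. [folklore] -/
def TLow (p : (fishNu hε hε2).Surgered) : Prop :=
  ∃ (x : ThreeTorus) (t : ℝ), p = toSurg (fishNu hε hε2) (mtPt tubeShearDiffeo x t) ∧ 1 / 2 < t ∧ t < tH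

/-- An old point `[x, t]`, `1/2 < t < 7/8`, with fibre angle in `[0, 5/2]`. [folklore] -/
def U3Pt (p : (fishNu hε hε2).Surgered) : Prop :=
  ∃ (x : ThreeTorus) (t y : ℝ), p = toSurg (fishNu hε hε2) (mtPt tubeShearDiffeo x t) ∧ 1 / 2 < t ∧ t < 7 / 8 ∧
    x.2.1 = Circle.exp y ∧ 0 ≤ y ∧ y ≤ 5 / 2

variable {hε hε2}

/-- `YSmall hε hε2 (toSurg (fishNu hε hε2) (mtCoord tubeShearDiffeo (v, s)))`. [folklore] -/
theorem ySmall_mtCoord {v : 𝔼 3} {s : ℝ} (hs0 : 0 < s) (hs1 : s < 3 / 2) (hv : |v 1| ≤ 1 / 2) :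
    YSmall hε hε2 (toSurg (fishNu hε hε2) (mtCoord tubeShearDiffeo (v, s))) :=
  ⟨_, v 1, rfl, yC_mtCoord (q := (v, s)) hs0 hs1, hv⟩

/-- `YSmall hε hε2 (toSurg (fishNu hε hε2) (mtPt tubeShearDiffeo (z₁, Circle.exp y, z₃) s))`. [folklore] -/
theorem ySmall_mtPt {z₁ z₃ : Circle} {y s : ℝ} (hs0 : 0 < s) (hs1 : s < 3 / 2) (hy : |y| ≤ 1 / 2) :
    YSmall hε hε2 (toSurg (fishNu hε hε2) (mtPt tubeShearDiffeo (z₁, Circle.exp y, z₃) s)) :=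
  ⟨_, y, rfl, yC_mtPt _ hs0 hs1, hy⟩

variable (hε hε2)

/-! ### Offset bounds -/

include hε hε2 in
/-- `|κ(n) a| ≤ 1/2` for `0 ≤ n ≤ 1/2` and admissible `a`. [folklore] -/
theorem abs_kap_mul_le {n a : ℝ} (hn0 : 0 ≤ n) (hn1 : n ≤ 1 / 2) (ha : |a| < rhoB ε hε hε2) : |kap ε n * a| ≤ 1 / 2 := by
  obtain ⟨hk1, hk2⟩ := kap_mem (ε := ε) n
  have hl := lam_le ε hε; have hl0 := lam_pos ε hε
  have hρ := rhoB_le hε hε2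
  have hk0 : 0 ≤ kap ε n := le_trans (le_min hn0 hl0.le) hk1
  have hk3 : kap ε n ≤ 1 / 2 := hk2.trans (max_le hn1 (by linarith))
  rw [abs_mul, abs_of_nonneg hk0]
  nlinarith [abs_nonneg a]

include hε hε2 in
/-- `|λ a| ≤ 1/2` for admissible `a`. [folklore] -/
theorem abs_lam_mul_le {a : ℝ} (ha : |a| < rhoB ε hε hε2) : |lam ε * a| ≤ 1 / 2 := by
  have hl := lam_le ε hε; have hl0 := lam_pos ε hε
  have hρ := rhoB_le hε hε2
  rw [abs_mul, abs_of_pos hl0]; nlinarith [abs_nonneg a]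

/-! ### The `D⁰` windows -/

include hε2 in
/-- **The south window** is new or has small fibre angle. [folklore] -/
theorem winS_taxonomy {q : ℂ × ℝ × ℝ} (hq : q.2 ∈ AdmP ε hε hε2) :
    NewPt hε hε2 ((fishT ε hε hε2).winS q) ∨ YSmall hε hε2 ((fishT ε hε hε2).winS q) := by
  obtain ⟨-, -, ha, -, -⟩ := adm_bounds hε2 hq
  rw [TubeDData.winS, tubeD0S]
  by_cases h : ‖q.1‖ < 1 / 2
  · left; rw [glueBy_of_lt (τ := fun q : ℂ × ℝ × ℝ ↦ ‖q.1‖) h]; exact ⟨_, rfl⟩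
  · right; rw [glueBy_of_le (τ := fun q : ℂ × ℝ × ℝ ↦ ‖q.1‖) (not_lt.1 h), pieceS2, polarForm_apply, zoneS2n_apply, scaleReal]
    have hb := baseOf_mem' (exp (arg q.1 * I))
    refine ySmall_mtCoord hb.1 hb.2 ?_
    have hn0 : 0 ≤ -capN ε q.1 := by
      by_cases h0 : q.1 = 0
      · rw [h0, capN, norm_zero, capLat]; simp
      · exact (neg_capN_pos hε h0).le
    simp only [show (fishT ε hε hε2).kapS = kap ε from rfl, show (fishT ε hε hε2).ε = ε from rfl]
    simpa using abs_kap_mul_le hε hε2 hn0 (by linarith [neg_capN_lt_eps hε q.1]) ha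

include hε2 in
/-- **The flat-annulus window** has small fibre angle. [folklore] -/
theorem winA_taxonomy {q : ℂ × ℝ × ℝ} (hq : q.2 ∈ AdmP ε hε hε2) (hn0 : 0 ≤ (fishT ε hε hε2).nfun ‖q.1‖) :
    YSmall hε hε2 ((fishT ε hε hε2).winA q) := by
  obtain ⟨-, -, ha, -, -⟩ := adm_bounds hε2 hq
  set T := fishT ε hε hε2 with hT
  set n := T.nfun ‖q.1‖ with hn
  have hb := baseOf_mem' (exp (arg q.1 * I))
  have hnA : T.nA = 33 * ε / 50 := rfl
  rw [TubeDData.winA, radialForm_apply, tubeD0A]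
  change YSmall hε hε2 (glue2 T.nA (pieceA2 T.hε T.hε2 T.kapS) (glue2 T.nB (pieceA3 T.hε T.hε2 T.lam T.μS) (pieceAM T.hε T.hε2 T.δ T.lam T.cut))
    (n, arg q.1, q.2))
  by_cases hA : n < T.nA
  · rw [glue2_of_lt hA, pieceA2, zoneS2_apply, scaleReal]
    refine ySmall_mtCoord hb.1 hb.2 ?_
    simp only [show T.kapS = kap ε from rfl]
    simpa using abs_kap_mul_le hε hε2 hn0 (by rw [hnA] at hA; linarith) ha
  rw [glue2_of_le (not_lt.1 hA)]
  by_cases hB : n < T.nB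
  · rw [glue2_of_lt hB, pieceA3, zoneS3_apply, switchXReal]
    refine ySmall_mtCoord hb.1 hb.2 ?_
    have := abs_lam_mul_le hε hε2 ha
    simpa [show T.lam = lam ε from rfl] using this
  · rw [glue2_of_le (not_lt.1 hB), pieceAM, zoneM_apply, midT3]
    simp only [show T.lam = lam ε from rfl]
    exact ySmall_mtPt hb.1 hb.2 (abs_lam_mul_le hε hε2 ha)

include hε2 in
/-- **The north window** is new or has small fibre angle. [folklore] -/
theorem winN_taxonomy {q : ℂ × ℝ × ℝ} (hq : q.2 ∈ AdmP ε hε hε2) :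
    NewPt hε hε2 ((fishT ε hε hε2).winN q) ∨ YSmall hε hε2 ((fishT ε hε hε2).winN q) := by
  obtain ⟨-, -, ha, -, -⟩ := adm_bounds hε2 hq
  set d : ℂ := (fishT ε hε hε2).tdisc (radMapW (fishT ε hε hε2).Pfun q).1 with hd
  have hTε : (fishT ε hε hε2).ε = ε := rfl
  have hTk : (fishT ε hε hε2).kapN = kap ε := rfl
  have hTl : (fishT ε hε hε2).lam = lam ε := rfl
  have hb := baseOf_mem' (exp (arg d * I))
  have hn0 : 0 ≤ -capN ε d := by
    by_cases h0 : d = 0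
    · rw [h0, capN, norm_zero, capLat]; simp
    · exact (neg_capN_pos hε h0).le
  have hn1 : -capN ε d ≤ 1 / 2 := by linarith [neg_capN_lt_eps hε d]
  rw [TubeDData.winN]
  change NewPt hε hε2 (tubeD0N (fishT ε hε hε2).hε (fishT ε hε hε2).hε2 (capTj (fishT ε hε hε2).ε (fishT ε hε hε2).nj) (fishT ε hε hε2).δ (fishT ε hε hε2).rσ₁ (fishT ε hε hε2).rσ₂ (fishT ε hε hε2).rσ₃ (fishT ε hε hε2).lam (fishT ε hε hε2).cN (fishT ε hε hε2).kapN (fishT ε hε hε2).μN (fishT ε hε hε2).cut (fishT ε hε hε2).RM (d, q.2)) ∨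
    YSmall hε hε2 (tubeD0N (fishT ε hε hε2).hε (fishT ε hε hε2).hε2 (capTj (fishT ε hε hε2).ε (fishT ε hε hε2).nj) (fishT ε hε hε2).δ (fishT ε hε hε2).rσ₁ (fishT ε hε hε2).rσ₂ (fishT ε hε hε2).rσ₃ (fishT ε hε hε2).lam (fishT ε hε hε2).cN (fishT ε hε hε2).kapN (fishT ε hε hε2).μN (fishT ε hε hε2).cut (fishT ε hε hε2).RM (d, q.2))
  rw [tubeD0N]
  by_cases h1 : ‖d‖ < 1 / 2
  · left; rw [glueBy_of_lt (τ := fun q : ℂ × ℝ × ℝ ↦ ‖q.1‖) (by exact h1)]; exact ⟨_, rfl⟩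
  right
  rw [glueBy_of_le (τ := fun q : ℂ × ℝ × ℝ ↦ ‖q.1‖) (not_lt.1 h1)]
  by_cases h2 : ‖d‖ < 13 / 20
  · rw [glueBy_of_lt (τ := fun q : ℂ × ℝ × ℝ ↦ ‖q.1‖) (by exact h2), pieceN2, polarForm_apply, zoneN2_apply, scaleRealN_apply]
    dsimp only
    refine ySmall_mtCoord hb.1 hb.2 ?_
    simp only [hTk, hTε]
    simpa using abs_kap_mul_le hε hε2 hn0 hn1 ha
  rw [glueBy_of_le (τ := fun q : ℂ × ℝ × ℝ ↦ ‖q.1‖) (not_lt.1 h2)]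
  by_cases h3 : ‖d‖ < 4 / 5
  · rw [glueBy_of_lt (τ := fun q : ℂ × ℝ × ℝ ↦ ‖q.1‖) (by exact h3), pieceN3, polarForm_apply, zoneN3_apply]
    dsimp only
    have hform : ∀ (μ : ℝ → ℝ) (k n s : ℝ) (w : ℝ × ℝ), switchXRealN μ k (n, s, w) = mirrorL (switchXReal μ k (n, s, w.1, -w.2)) :=
      fun _ _ _ _ _ ↦ rfl
    rw [hform, switchXReal, mirrorL_apply]
    refine ySmall_mtCoord hb.1 hb.2 ?_
    have := abs_lam_mul_le hε hε2 ha
    simpa [hTl] using this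
  rw [glueBy_of_le (τ := fun q : ℂ × ℝ × ℝ ↦ ‖q.1‖) (not_lt.1 h3)]
  by_cases h4 : ‖d‖ < (fishT ε hε hε2).RM
  · rw [glueBy_of_lt (τ := fun q : ℂ × ℝ × ℝ ↦ ‖q.1‖) (by exact h4), pieceN4, polarForm_apply, zoneN4_apply, northT3]
    dsimp only
    exact ySmall_mtPt hb.1 hb.2 (abs_lam_mul_le hε hε2 ha)
  · rw [glueBy_of_le (τ := fun q : ℂ × ℝ × ℝ ↦ ‖q.1‖) (not_lt.1 h4), pieceM, polarForm_apply, zoneM_apply, midT3]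
    dsimp only
    exact ySmall_mtPt hb.1 hb.2 (abs_lam_mul_le hε hε2 ha)

/-! ### The upper windows -/

/-- `|Kc| ≤ 1` and `|Pc| ≤ 1` for the flat shell. [folklore] -/
theorem abs_flatKc_le {ρ : ℝ} (hρ : 0 < ρ) (u₀ : ℝ) : |flatKc ρ u₀| ≤ 1 := by
  have hm := flatM_mem (ρ := ρ) u₀
  have hD : ρ ≤ flatD ρ u₀ := by rw [flatD]; exact (Real.le_sqrt' hρ).2 (by nlinarith)
  have hq0 : 0 ≤ flatQ ρ u₀ := by rw [flatQ]; exact div_nonneg hρ.le (Real.sqrt_nonneg _)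
  have hq1 : flatQ ρ u₀ ≤ 1 := by rw [flatQ, div_le_one (lt_of_lt_of_le hρ hD)]; exact hD
  rw [flatKc, abs_le]; constructor <;> nlinarith [hm.1, hm.2]

/-- `0 ≤ Kc ≤ 1` and `|Pc| ≤ 1` for the foot shell. [folklore] -/
theorem footKc_mem {ρ : ℝ} (hρ : 0 < ρ) (y : ℝ) : 0 ≤ footKc ρ y ∧ footKc ρ y ≤ 1 := by
  have hm := footM_mem (ρ := ρ) y
  have hD : ρ ≤ footD ρ y := by rw [footD]; exact (Real.le_sqrt' hρ).2 (by nlinarith)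
  have hD0 : 0 < footD ρ y := lt_of_lt_of_le hρ hD
  have hq0 : 0 ≤ ρ / footD ρ y := div_nonneg hρ.le hD0.le
  have hq1 : ρ / footD ρ y ≤ 1 := by rw [div_le_one hD0]; exact hD
  rw [footKc]; constructor <;> nlinarith [hm.1, hm.2]

/-- **Offset bounds for the planar path**: `ρ - |a| ≤ X ≤ 4ρ + |a|`-type bounds and `|Y| ≤ 3ρ + |a|`
resp. `Y = y(ψ) + a Pc` on the foot. [folklore] -/
theorem pathShell_offset {ρ : ℝ} (hρ : 0 < ρ) {ψ a : ℝ} (h1 : -(π / 4) ≤ ψ) (h2 : ψ < π) (ha : |a| < ρ) :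
    ((ψ < π / 6 → (pathShell ρ (ψ, a)).1 ≤ flatU ρ ψ + |a|) ∧ (π / 6 ≤ ψ → (pathShell ρ (ψ, a)).1 ≤ 3 * ρ + |a|) ∧
      ρ - |a| ≤ (pathShell ρ (ψ, a)).1) ∧
    (ψ ≤ π / 2 → |(pathShell ρ (ψ, a)).2| ≤ 3 * ρ + |a|) ∧
    (π / 2 < ψ → (pathShell ρ (ψ, a)).2 = footY ρ ψ + a * footPc ρ (footY ρ ψ)) := by
  have hπ := Real.pi_pos
  have hA2 := pi_div_three_lt_arctan_two
  have hah := arctan_half_lt_pi_div_six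
  have haa := abs_nonneg a
  have hla := le_abs_self a; have hna := neg_abs_le a
  refine ⟨⟨fun hlt ↦ ?_, fun hge ↦ ?_, ?_⟩, ?_, fun hgt ↦ by rw [pathShell_eq_foot hρ (q := (ψ, a)) (by linarith), footPt]⟩
  · rw [pathShell_eq_flat hρ (q := (ψ, a)) hlt, flatPt]
    simp only
    have hP := abs_flatPc_le hρ (flatU ρ ψ)
    have hmul : |a * flatPc ρ (flatU ρ ψ)| ≤ |a| := by rw [abs_mul]; nlinarith [abs_nonneg (flatPc ρ (flatU ρ ψ))]
    linarith [(abs_le.1 hmul).2]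
  · rcases le_or_gt ψ (π / 2) with hle | hgt
    · rw [pathShell_eq_bend hρ (q := (ψ, a)) (by linarith) (by linarith [Real.arctan_lt_pi_div_two (2:ℝ)]), bendPt]
      simp only
      obtain ⟨hR1, hR2⟩ := bendR_mem hρ (show -(π / 6) < ψ by linarith) (show ψ < 2 * π / 3 by linarith)
      have hs0 : 0 ≤ Real.sin ψ := Real.sin_nonneg_of_nonneg_of_le_pi (by linarith) (by linarith)
      obtain ⟨ha1, ha2⟩ := abs_lt.1 ha
      have : 0 ≤ (bendR ρ ψ - a) * Real.sin ψ := mul_nonneg (by linarith) hs0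
      linarith
    · rw [pathShell_eq_foot hρ (q := (ψ, a)) (by linarith), footPt]
      simp only
      obtain ⟨hK0, hK1⟩ := footKc_mem hρ (footY ρ ψ)
      have hmul : |a * footKc ρ (footY ρ ψ)| ≤ |a| := by rw [abs_mul, abs_of_nonneg hK0]; nlinarith
      linarith [(abs_le.1 hmul).2]
  · rcases lt_or_ge ψ (π / 6) with hlt | hge
    · rw [pathShell_eq_flat hρ (q := (ψ, a)) hlt, flatPt]
      simp only
      have hP := abs_flatPc_le hρ (flatU ρ ψ)
      have hmul : |a * flatPc ρ (flatU ρ ψ)| ≤ |a| := by rw [abs_mul]; nlinarith [abs_nonneg (flatPc ρ (flatU ρ ψ))]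
      have hfl : 2 * ρ ≤ flatU ρ ψ := by
        rw [flatU]
        have := tan_le_tan_of_le (by linarith) hlt.le (by linarith)
        rw [Real.tan_pi_div_six] at this
        have h3 := inv_sqrt_three_bounds; nlinarith [h3.2]
      linarith [(abs_le.1 hmul).1]
    rcases le_or_gt ψ (π / 2) with hle | hgt
    · rw [pathShell_eq_bend hρ (q := (ψ, a)) (by linarith) (by linarith [Real.arctan_lt_pi_div_two (2:ℝ)]), bendPt]
      simp only
      obtain ⟨hR1, hR2⟩ := bendR_mem hρ (show -(π / 6) < ψ by linarith) (show ψ < 2 * π / 3 by linarith)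
      have hs0 : 0 ≤ Real.sin ψ := Real.sin_nonneg_of_nonneg_of_le_pi (by linarith) (by linarith)
      have hs1 : Real.sin ψ ≤ 1 := Real.sin_le_one ψ
      obtain ⟨ha1, ha2⟩ := abs_lt.1 ha
      have : (bendR ρ ψ - a) * Real.sin ψ ≤ (bendR ρ ψ - a) * 1 := mul_le_mul_of_nonneg_left hs1 (by linarith)
      linarith
    · rw [pathShell_eq_foot hρ (q := (ψ, a)) (by linarith), footPt]
      simp only
      obtain ⟨hK0, hK1⟩ := footKc_mem hρ (footY ρ ψ)
      have hmul : |a * footKc ρ (footY ρ ψ)| ≤ |a| := by rw [abs_mul, abs_of_nonneg hK0]; nlinarith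
      linarith [(abs_le.1 hmul).1]
  · intro hle
    rcases lt_or_ge ψ (π / 6) with hlt | hge
    · rw [pathShell_eq_flat hρ (q := (ψ, a)) hlt, flatPt]
      simp only
      have hK := abs_flatKc_le hρ (flatU ρ ψ)
      rw [abs_mul]; nlinarith [abs_nonneg (flatKc ρ (flatU ρ ψ))]
    · rw [pathShell_eq_bend hρ (q := (ψ, a)) (by linarith) (by linarith [Real.arctan_lt_pi_div_two (2:ℝ)]), bendPt]
      simp only
      obtain ⟨hR1, hR2⟩ := bendR_mem hρ (show -(π / 6) < ψ by linarith) (show ψ < 2 * π / 3 by linarith)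
      have hc0 : 0 ≤ Real.cos ψ := Real.cos_nonneg_of_mem_Icc ⟨by linarith, hle⟩
      have hc1 : Real.cos ψ ≤ 1 := Real.cos_le_one ψ
      obtain ⟨ha1, ha2⟩ := abs_lt.1 ha
      have h3 : (bendR ρ ψ - a) * Real.cos ψ ≤ (bendR ρ ψ - a) * 1 := mul_le_mul_of_nonneg_left hc1 (by linarith)
      have h4 : 0 ≤ (bendR ρ ψ - a) * Real.cos ψ := mul_nonneg (by linarith) hc0
      rw [abs_le]; constructor <;> linarith

include hε in
/-- A chart point `d₀ + P` with `‖P‖ ≤ 3/10` has `capS ∈ (1/2, 1)`. [folklore] -/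
theorem capS_chart_mem {P : ℂ} (hP : ‖P‖ ≤ 3 / 10) : 1 / 2 < capS (capD0 ε (nj ε) + P) ∧ capS (capD0 ε (nj ε) + P) < 1 := by
  refine capS_mem_of_im_neg ?_
  obtain ⟨ht1, ht2⟩ := capTj_bounds (ε := ε) hε
  have him : (capD0 ε (nj ε) + P).im = -capTj ε (nj ε) + P.im := by rw [add_im, capD0_eq]; simp
  have hwi : |P.im| ≤ 3 / 10 := (abs_im_le_norm P).trans hP
  rw [him]; linarith [(abs_le.1 hwi).2]

include hε2 in
/-- **U5 has small fibre angle.** [folklore] -/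
theorem winU5_taxonomy {q : ℂ × ℝ × ℝ} (hq : q.2 ∈ AdmP ε hε hε2) (h1 : s3 ε - 1 / 10 < ‖q.1‖) (h2 : ‖q.1‖ < s4 ε) :
    YSmall hε hε2 ((fishT ε hε hε2).winU5 q) := by
  obtain ⟨hs, -, ha, hb, -⟩ := adm_bounds hε2 hq
  have hρ := ρA_pos; have hρv : ρA = 1 / 20 := rfl
  have hl := lam_le ε hε; have hl0 := lam_pos ε hε; have hρB := rhoB_le hε hε2
  have hπ := Real.pi_pos
  obtain ⟨hα1, hα2⟩ := alpha_winU5 (ε := ε) (r := ‖q.1‖) h1 (by linarith)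
  set α := angleUp (rzero ε) ‖q.1‖ with hα
  have hla : |lam ε * q.2.1| < ρA := by rw [abs_mul, abs_of_pos hl0]; nlinarith [abs_nonneg q.2.1]
  have hlb : |lam ε * q.2.2| ≤ 1 / 20 := by rw [abs_mul, abs_of_pos hl0]; nlinarith [abs_nonneg q.2.2]
  rw [TubeDData.winU5, radialForm_apply]
  show YSmall hε hε2 (pieceU5 _ _ (nj ε) ρA (α, arg q.1, lam ε * q.2.1, lam ε * q.2.2))
  rw [pieceU5, shellTubeMap, profTubeMap, profTube, dchartX, aConv]
  simp only
  obtain ⟨⟨hXf, hXb', hX2⟩, hYle, hYfoot⟩ := pathShell_offset hρ hα1.le (by linarith) hla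
  have hXb : (pathShell ρA (α, lam ε * q.2.1)).1 ≤ 1 / 4 := by
    rcases lt_or_ge α (π / 6) with hlt | hge
    · have hfl : flatU ρA α ≤ 4 * ρA := by
        rw [flatU]
        have := tan_le_tan_of_le (by linarith) hα1.le (by linarith)
        rw [Real.tan_neg, Real.tan_pi_div_four] at this; nlinarith
      linarith [hXf hlt, hla.le]
    · linarith [hXb' hge, hla.le]
  have hX0 : 0 ≤ (pathShell ρA (α, lam ε * q.2.1)).1 := by linarith [hla.le]
  have hP : ‖(((pathShell ρA (α, lam ε * q.2.1)).1 : ℝ) : ℂ) * exp (arg q.1 * I)‖ ≤ 3 / 10 := by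
    rw [norm_mul, Complex.norm_exp_ofReal_mul_I, mul_one, Complex.norm_real, Real.norm_eq_abs, abs_of_nonneg hX0]; linarith
  obtain ⟨hS1, hS2⟩ := capS_chart_mem hε hP
  refine ySmall_mtCoord (by linarith) (by linarith) ?_
  show |(pathShell ρA (α, lam ε * q.2.1)).2| ≤ 1 / 2
  rcases le_or_gt α (π / 2) with hle | hgt
  · linarith [hYle hle, hla.le]
  · rw [hYfoot hgt]
    obtain ⟨-, -, w34, w45, -⟩ := windows hε hε2
    obtain ⟨-, hy2, hy3, -⟩ := U4_mem hε hε2 (r := s4 ε) le_rfl (by linarith)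
    have hylt : footY ρA α < footY ρA (angleUp (rzero ε) (s4 ε)) :=
      strictMonoOn_footY hρ ⟨by linarith, by linarith⟩ ⟨by linarith [alpha_gt_pi_div_two (ε := ε) (r := s4 ε) (by linarith)], (angleUp_mem _ _).2⟩
        (strictMono_angleUp _ h2)
    have hy0 : 0 < footY ρA α := by
      have := footY_le_footY hρ (show 0 < π / 2 by linarith) hgt.le (by linarith)
      rw [footY, Real.cos_pi_div_two, zero_div, mul_zero, sub_zero] at this; linarith
    have hPc := abs_footPc_le hρ (footY ρA α)
    have hmul : |lam ε * q.2.1 * footPc ρA (footY ρA α)| ≤ 1 / 20 := by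
      rw [abs_mul]; nlinarith [abs_nonneg (footPc ρA (footY ρA α)), hla.le, abs_nonneg (lam ε * q.2.1)]
    rw [y4] at hy2
    rw [abs_le]; obtain ⟨hm1, hm2⟩ := abs_le.1 hmul; constructor <;> linarith

include hε2 in
/-- **U4 has small fibre angle.** [folklore] -/
theorem winU4_taxonomy {q : ℂ × ℝ × ℝ} (hq : q.2 ∈ AdmP ε hε hε2) (h1 : s4 ε ≤ ‖q.1‖) (h2 : ‖q.1‖ < s5 ε) :
    YSmall hε hε2 ((fishT ε hε hε2).winU4 q) := by
  obtain ⟨hs, -, ha, hb, -⟩ := adm_bounds hε2 hq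
  have hρ := ρA_pos; have hρv : ρA = 1 / 20 := rfl
  have hl := lam_le ε hε; have hl0 := lam_pos ε hε; have hρB := rhoB_le hε hε2
  obtain ⟨hy1, hy2, hy3, hy0⟩ := U4_mem hε hε2 h1 h2
  set y := footY ρA (angleUp (rzero ε) ‖q.1‖) with hy
  have hla : |lam ε * q.2.1| ≤ 1 / 20 := by rw [abs_mul, abs_of_pos hl0]; nlinarith [abs_nonneg q.2.1]
  have hlb : |lam ε * q.2.2| ≤ 1 / 20 := by rw [abs_mul, abs_of_pos hl0]; nlinarith [abs_nonneg q.2.2]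
  rw [TubeDData.winU4, radialForm_apply]
  show YSmall hε hε2 (pieceU4 _ _ (nj ε) ρA (y, arg q.1, lam ε * q.2.1, lam ε * q.2.2))
  rw [pieceU4, tubeUpMap, tubeUp, dchartX, aConv]
  simp only
  have hu := uU_mem hρ y
  obtain ⟨hK0, hK1⟩ := footKc_mem hρ y
  have hχ := chiU_mem (ρ := ρA) y
  have hP : ‖((((uU ρA y + lam ε * q.2.1 * footKc ρA y : ℝ) : ℂ) + (((1 - chiU ρA y) * (lam ε * q.2.2) : ℝ) : ℂ) * I) *
      exp (arg q.1 * I))‖ ≤ 3 / 10 := by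
    rw [norm_mul, Complex.norm_exp_ofReal_mul_I, mul_one]
    refine (norm_add_le _ _).trans ?_
    rw [norm_mul, Complex.norm_I, mul_one, Complex.norm_real, Complex.norm_real, Real.norm_eq_abs, Real.norm_eq_abs]
    have h1' : |uU ρA y + lam ε * q.2.1 * footKc ρA y| ≤ 3 / 20 := by
      rw [abs_le]; constructor <;> nlinarith [hu.1, hu.2, abs_le.1 hla, hK0, hK1, abs_nonneg (lam ε * q.2.1)]
    have h2' : |(1 - chiU ρA y) * (lam ε * q.2.2)| ≤ 1 / 20 := by
      rw [abs_mul, abs_of_nonneg (by linarith [hχ.2])]; nlinarith [hχ.1, abs_nonneg (lam ε * q.2.2)]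
    linarith
  obtain ⟨hS1, hS2⟩ := capS_chart_mem hε hP
  refine ySmall_mtCoord (by linarith) (by linarith) ?_
  show |y + lam ε * q.2.1 * footPc ρA y| ≤ 1 / 2
  have hyy : y4 ε ‖q.1‖ = y := rfl
  rw [hyy] at hy1 hy2
  have hPc := abs_footPc_le hρ y
  have hmul : |lam ε * q.2.1 * footPc ρA y| ≤ 1 / 20 := by
    rw [abs_mul]; nlinarith [abs_nonneg (footPc ρA y), abs_nonneg (lam ε * q.2.1)]
  rw [abs_le]; obtain ⟨hm1, hm2⟩ := abs_le.1 hmul; constructor <;> linarith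

include hε2 in
/-- **U3 is a vertical-segment point.** [folklore] -/
theorem winU3_taxonomy {q : ℂ × ℝ × ℝ} (hq : q.2 ∈ AdmP ε hε hε2) (h1 : s5 ε ≤ ‖q.1‖) (h2 : ‖q.1‖ < s6 ε) :
    U3Pt hε hε2 ((fishT ε hε hε2).winU3 q) := by
  obtain ⟨hs, hpos, ha, hb, -⟩ := adm_bounds hε2 hq
  have hl0 := lam_pos ε hε
  obtain ⟨hy1, hy2, h6a, h6b⟩ := U3_mem hε hε2 h1 h2
  obtain ⟨-, -, -, w45, w56, -⟩ := windows hε hε2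
  obtain ⟨-, -, hy53, hy40⟩ := U4_mem hε hε2 (r := s4 ε) le_rfl (by linarith)
  have hy45 : footY ρA (angleUp (rzero ε) (s4 ε)) ≤ footY ρA (angleUp (rzero ε) (s5 ε)) :=
    footY_le_footY ρA_pos (by linarith [alpha_gt_pi_div_two (ε := ε) (r := s4 ε) (by linarith), Real.pi_pos])
      ((strictMono_angleUp _).monotone (by linarith : s4 ε ≤ s5 ε)) (angleUp_mem _ _).2
  have hyf : (fishT ε hε hε2).yfun ‖q.1‖ = (fishTref ε hε hε2).yfun ‖q.1‖ := rfl
  set y := (fishT ε hε hε2).yfun ‖q.1‖ with hy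
  -- the chart value is small (as in `ldU3_holds`)
  set w : ℂ := ((lam ε * q.2.1 : ℝ) : ℂ) + ((lam ε * q.2.2 : ℝ) : ℂ) * I with hw
  have hwn : ‖w‖ < lam ε * rhoB ε hε hε2 := by
    have : ‖w‖ = lam ε * Real.sqrt (q.2.1 ^ 2 + q.2.2 ^ 2) := by
      rw [hw, Complex.norm_def, Complex.normSq_apply]; simp
      rw [show lam ε * q.2.1 * (lam ε * q.2.1) + lam ε * q.2.2 * (lam ε * q.2.2) = lam ε ^ 2 * (q.2.1 ^ 2 + q.2.2 ^ 2) by ring,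
        Real.sqrt_mul (sq_nonneg _), Real.sqrt_sq hl0.le]
    rw [this]; exact mul_lt_mul_of_pos_left hs hl0
  obtain ⟨hS1, hS2⟩ := lam_rhoB_S_lt (hε := hε) hε2
  have hS0 : 0 < (vert ε hε hε2).S := lt_of_lt_of_le one_pos (vert ε hε hε2).one_le_S
  set v := (vert ε hε hε2).frameL y (w * exp (arg q.1 * I)) with hv
  have hvn : ‖v‖ < vertRad hε (nj_sq_lt ε hε) (nj_neg ε hε) := by
    have := norm_frameL_mul_exp_le (vert ε hε hε2) y (arg q.1) w
    nlinarith [mul_le_mul_of_nonneg_left hwn.le hS0.le]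
  obtain ⟨hc1, hc2⟩ := vertRad_spec hε (nj_sq_lt ε hε) (nj_neg ε hε) ((vert ε hε hε2).m y) ((vert ε hε hε2).m_mem y) v hvn
  have hc2' := abs_lt.1 hc2
  rw [TubeDData.winU3, radialForm_apply]
  show U3Pt hε hε2 (pieceU3 _ _ (nj ε) (vert ε hε hε2) (y, arg q.1, lam ε * q.2.1, lam ε * q.2.2))
  rw [pieceU3, physX]
  simp only [Complex.ofReal_mul]
  rw [show ((lam ε : ℂ) * (q.2.1 : ℂ)) + (lam ε : ℂ) * (q.2.2 : ℂ) * I = w by rw [hw]; push_cast; ring]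
  have hcore : vertCore ε (nj ε) (vert ε hε hε2) y (arg q.1) w = ((nj ε, (3 : ℝ) / 4) : ℝ × ℝ) + capSwitchMap ε (nj ε) ((vert ε hε hε2).m y) v := rfl
  rw [hcore, mtCoord]
  refine ⟨_, _, y, rfl, ?_, ?_, rfl, by linarith, ?_⟩
  · show 1 / 2 < 3 / 4 + (capSwitchMap ε (nj ε) ((vert ε hε hε2).m y) v).2; linarith
  · show 3 / 4 + (capSwitchMap ε (nj ε) ((vert ε hε hε2).m y) v).2 < 7 / 8; linarith
  · have hRv : R0 = 1 / 5 := rfl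
    rw [cY] at hy2; linarith [Real.pi_lt_d2]

include hε2 in
/-- **U2 is a low point**: `t ≤ 19/20 + max (1/94, ρ_b) < t_H`. [folklore] -/
theorem winU2_taxonomy {q : ℂ × ℝ × ℝ} (hq : q.2 ∈ AdmP ε hε hε2) (h1 : s6 ε ≤ ‖q.1‖) (h2 : ‖q.1‖ < s7 ε) :
    TLow hε hε2 ((fishT ε hε hε2).winU2 q) := by
  obtain ⟨hs, hpos, ha, hb, -⟩ := adm_bounds hε2 hq
  have hπ := Real.pi_pos
  have hρ := R0_pos; have hRv : R0 = 1 / 5 := rfl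
  have hρB := rhoB_le' hε hε2
  have htan := tan_beta7_ge (ε := ε)
  obtain ⟨-, -, -, -, w56, w67, w6, -⟩ := windows hε hε2
  obtain ⟨hβ1, hβ2⟩ := beta_winU2 (ε := ε) (r := ‖q.1‖) (by linarith) (by linarith)
  set β := angleDown (rone ε) ‖q.1‖ with hβ
  have hβ7 : beta7 ε < β := strictAnti_angleDown _ h2
  have hβπ : β < π := (angleDown_mem _ _).2
  obtain ⟨hr1, hr2⟩ := abs_rotAB_le (arg q.1) q.2.1 q.2.2
  set a' := (rotAB (arg q.1) q.2.1 q.2.2).1 with ha'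
  have ha'' : |a'| < R0 := by linarith [rhoB_le hε hε2]
  rw [TubeDData.winU2, radialForm_apply]
  show TLow hε hε2 (pieceU2 _ _ (nj ε) R0 cY (3 / 4 - 2 * R0) (β, arg q.1, q.2))
  rw [pieceU2, physX, mtCoord]
  refine ⟨_, _, rfl, ?_, ?_⟩
  · show 1 / 2 < 3 / 4 - 2 * R0 + (pathShell R0 (β, a')).1
    obtain ⟨⟨-, -, hX2⟩, -⟩ := pathShell_offset hρ hβ1.le hβπ ha''
    linarith [hr1.trans hs.le]
  · show 3 / 4 - 2 * R0 + (pathShell R0 (β, a')).1 < tH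
    rw [tH_eq]
    have hah := arctan_half_lt_pi_div_six
    have hA2 := pi_div_three_lt_arctan_two
    have habs : |a'| ≤ 1 / 26 := by linarith [hr1.trans hs.le]
    rcases lt_or_ge β (π / 6) with hlt | hge
    · rw [pathShell_eq_flat hρ (q := (β, a')) hlt, flatPt]
      simp only
      by_cases hb0 : β ≤ 0
      · -- `u₀ ≥ 3ρ`: no horizontal displacement; `tan β ≥ tan β₇ ≥ -1/19`
        have ht0 : Real.tan β ≤ 0 := by
          rcases hb0.lt_or_eq with hlt0 | heq0
          · exact (Real.tan_neg_of_neg_of_pi_div_two_lt hlt0 (by linarith)).le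
          · rw [heq0, Real.tan_zero]
        have hu : 3 * R0 ≤ flatU R0 β := by rw [flatU]; nlinarith
        rw [flatPc, flatM_of_ge hρ hu, zero_mul, mul_zero, add_zero, flatU]
        have ht7 : Real.tan (beta7 ε) < Real.tan β :=
          Real.tan_lt_tan_of_lt_of_lt_pi_div_two (by linarith [(beta7_bounds ε).1]) (by linarith) hβ7
        rw [hRv]; linarith
      · rw [not_le] at hb0
        have ht0 : 0 < Real.tan β := Real.tan_pos_of_pos_of_lt_pi_div_two hb0 (by linarith)
        have hP := abs_flatPc_le hρ (flatU R0 β)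
        have hmul : |a' * flatPc R0 (flatU R0 β)| ≤ 1 / 26 := by rw [abs_mul]; nlinarith [abs_nonneg (flatPc R0 (flatU R0 β)), abs_nonneg a']
        rw [flatU, hRv] at *
        linarith [(abs_le.1 hmul).2]
    rcases le_or_gt β (π / 2) with hle | hgt
    · rw [pathShell_eq_bend hρ (q := (β, a')) (by linarith) (by linarith [Real.arctan_lt_pi_div_two (2:ℝ)]), bendPt]
      simp only
      obtain ⟨hR1, hR2⟩ := bendR_mem hρ (show -(π / 6) < β by linarith) (show β < 2 * π / 3 by linarith)
      have hs0 : 0 ≤ Real.sin β := Real.sin_nonneg_of_nonneg_of_le_pi (by linarith) (by linarith)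
      have : 0 ≤ (bendR R0 β - a') * Real.sin β := mul_nonneg (by linarith [(abs_lt.1 ha'').2]) hs0
      rw [hRv] at *; linarith
    · rw [pathShell_eq_foot hρ (q := (β, a')) (by linarith), footPt]
      simp only
      obtain ⟨hK0, hK1⟩ := footKc_mem hρ (footY R0 β)
      have hmul : |a' * footKc R0 (footY R0 β)| ≤ 1 / 26 := by rw [abs_mul, abs_of_nonneg hK0]; nlinarith [abs_nonneg a']
      rw [hRv] at *; linarith [(abs_le.1 hmul).2]

/-- The hole radius of the end map: `r_h = ρ_b - δ_c - p₁ - E₁/c`. [folklore] -/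
def rhJ (ε : ℝ) (hε : 0 < ε) (hε2 : ε ≤ 1 / 2) : ℝ := rhoB ε hε hε2 - delC ε hε hε2 - p1 ε hε hε2 - E1 / cL ε hε hε2

include hε hε2 in
/-- `c r_h = L_c - 1/20 - E₁`. [folklore] -/
theorem cL_mul_rhJ : cL ε hε hε2 * rhJ ε hε hε2 = Lc ε - 1 / 20 - E1 := by
  have hc := (cL_pos ε hε hε2).ne'
  rw [rhJ, mul_sub, mul_sub, mul_sub, cL_mul_rhoB', delC, p1]
  field_simp
  ring

include hε2 in
/-- **The leg window below the hole radius is a low point.** [folklore] -/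
theorem winU1_taxonomy {q : ℂ × ℝ × ℝ} (hq : q.2 ∈ AdmP ε hε hε2) (h1 : s7 ε ≤ ‖q.1‖) (h2 : ‖q.1‖ < cL ε hε hε2 * rhJ ε hε hε2) :
    TLow hε hε2 ((fishT ε hε hε2).winU1 q) := by
  obtain ⟨hs, hpos, ha, hb, hlo⟩ := adm_bounds hε2 hq
  have hc := cL_pos ε hε hε2
  have hE := E1_le; have hE0 := E1_pos
  have hη := eta_pos ε hε; have hη' := eta_lt hε hε2
  have htan := tan_beta7_ge (ε := ε); have htan' := (tan_beta7_bounds ε).2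
  rw [cL_mul_rhJ hε hε2] at h2
  set r := ‖q.1‖ with hr
  set m := Real.sqrt (q.2.1 ^ 2 + q.2.2 ^ 2) with hm
  -- the position
  have hmono := strictMonoOn_posL hε hε2
  have hpos7 : (fishTref ε hε hε2).posL (s7 ε) ≤ (fishTref ε hε hε2).posL r :=
    hmono.monotoneOn (by simp) (by show s7 ε - 3 / 100 < r; linarith) h1
  rw [posL_s7 hε hε2] at hpos7
  have hup : (fishTref ε hε hε2).posL r ≤ r + 1 / 2500 := by
    rw [fishTref_eq, posL_eq]
    by_cases hb8 : b8 ε ≤ r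
    · rw [blendFun_of_one (stdBlend_of_ge (by unfold a8 b8; linarith) hb8)]; linarith
    · rw [not_le] at hb8
      have h3 : |r - s7 ε| ≤ 3 / 100 := by unfold b8 at hb8; rw [abs_le]; constructor <;> linarith
      have h4 := abs_rL_sub_le hε hε2 (c := 1) (ρb := Lc ε) (μ := fun _ ↦ (0:ℝ)) (one_mul _) h3
      have h5 : (fishTgen ε hε hε2 1 (Lc ε) fun _ ↦ (0:ℝ)).rL (angleDown (rone ε) r) ≤ r + 1 / 2500 := by
        have := (abs_le.1 h4).2
        unfold b8 at hb8
        have hrs : |r - s7 ε| = r - s7 ε := abs_of_nonneg (by linarith)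
        rw [hrs] at this; linarith
      rw [blendFun]
      have hχ := stdBlend_mem (a8 ε) (b8 ε) r
      nlinarith [hχ.1, hχ.2]
  -- the shift
  have hshift0 : 0 ≤ 2 * cL ε hε hε2 * (rhoB ε hε hε2 - m) * muL ε ((fishTref ε hε hε2).posL r) ∧
      2 * cL ε hε hε2 * (rhoB ε hε hε2 - m) * muL ε ((fishTref ε hε hε2).posL r) ≤ 2 * E1 := by
    have := legShift_mem hε hε2 hq r; rwa [legShift] at this
  rw [TubeDData.winU1, radialForm_apply, posL_eq_ref]
  show TLow hε hε2 (pieceU1 _ _ (nj ε) cY (cL ε hε hε2) (rhoB ε hε hε2) (muL ε) ((fishTref ε hε hε2).posL r, arg q.1, q.2))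
  rw [pieceU1, physX, mtCoord]
  refine ⟨_, _, rfl, ?_, ?_⟩
  · show 1 / 2 < legT (muL ε) (cL ε hε hε2) (rhoB ε hε hε2) ((fishTref ε hε hε2).posL r) m
    rw [legT, cL_mul_rhoB', bxH]; linarith [hshift0.1]
  · show legT (muL ε) (cL ε hε hε2) (rhoB ε hε hε2) ((fishTref ε hε hε2).posL r) m < tH
    rw [legT, cL_mul_rhoB', tH, bxH]; linarith [hshift0.2]

include hε2 in
/-- **Taxonomy of the hole points**: every tube point `tubeD (ζ, w)` with `‖ζ‖ < c r_h` and `w`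
admissible is new, has small fibre angle, is a vertical-segment point, or is low. [folklore] -/
theorem hole_taxonomy {q : ℂ × ℝ × ℝ} (hq : q.2 ∈ AdmP ε hε hε2) (hr : ‖q.1‖ < cL ε hε hε2 * rhJ ε hε hε2) :
    NewPt hε hε2 ((fishT ε hε hε2).tubeD q) ∨ YSmall hε hε2 ((fishT ε hε hε2).tubeD q) ∨
      U3Pt hε hε2 ((fishT ε hε hε2).tubeD q) ∨ TLow hε hε2 ((fishT ε hε hε2).tubeD q) := by
  set T := fishT ε hε hε2 with hT
  obtain ⟨w12, w23, w34, w45, w56, w67, -⟩ := windows hε hε2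
  obtain ⟨-, w3r⟩ := s2_lt_s3 hε hε2
  have e1 : T.s₁ = 3 / 4 := rfl
  have e2 : T.s₂ = s2 ε := rfl
  have e3 : T.s₃ = s3 ε := rfl
  have e4 : T.s₄ = s4 ε := rfl
  have e5 : T.s₅ = s5 ε := rfl
  have e6 : T.s₆ = s6 ε := rfl
  have e7 : T.s₇ = s7 ε := rfl
  rw [TubeDData.tubeD, e1, e2, e3, e4, e5, e6, e7]
  by_cases h1 : ‖q.1‖ < 3 / 4
  · rw [glueBy_of_lt (τ := fun q : ℂ × ℝ × ℝ ↦ ‖q.1‖) (by exact h1)]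
    rcases winS_taxonomy hε hε2 hq with h | h
    · exact Or.inl h
    · exact Or.inr (Or.inl h)
  rw [glueBy_of_le (τ := fun q : ℂ × ℝ × ℝ ↦ ‖q.1‖) (not_lt.1 h1)]
  by_cases h2 : ‖q.1‖ < s2 ε
  · rw [glueBy_of_lt (τ := fun q : ℂ × ℝ × ℝ ↦ ‖q.1‖) (by exact h2)]
    refine Or.inr (Or.inl (winA_taxonomy hε hε2 hq ?_))
    exact (nfun_pos hε hε2 (c := cL ε hε hε2) (ρb := rhoB ε hε hε2) (μ := muL ε) (by linarith) (by linarith)).le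
  rw [glueBy_of_le (τ := fun q : ℂ × ℝ × ℝ ↦ ‖q.1‖) (not_lt.1 h2)]
  by_cases h3 : ‖q.1‖ < s3 ε
  · rw [glueBy_of_lt (τ := fun q : ℂ × ℝ × ℝ ↦ ‖q.1‖) (by exact h3)]
    rcases winN_taxonomy hε hε2 hq with h | h
    · exact Or.inl h
    · exact Or.inr (Or.inl h)
  rw [glueBy_of_le (τ := fun q : ℂ × ℝ × ℝ ↦ ‖q.1‖) (not_lt.1 h3)]
  by_cases h4 : ‖q.1‖ < s4 ε
  · rw [glueBy_of_lt (τ := fun q : ℂ × ℝ × ℝ ↦ ‖q.1‖) (by exact h4)]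
    exact Or.inr (Or.inl (winU5_taxonomy hε hε2 hq (by linarith) h4))
  rw [glueBy_of_le (τ := fun q : ℂ × ℝ × ℝ ↦ ‖q.1‖) (not_lt.1 h4)]
  by_cases h5 : ‖q.1‖ < s5 ε
  · rw [glueBy_of_lt (τ := fun q : ℂ × ℝ × ℝ ↦ ‖q.1‖) (by exact h5)]
    exact Or.inr (Or.inl (winU4_taxonomy hε hε2 hq (not_lt.1 h4) h5))
  rw [glueBy_of_le (τ := fun q : ℂ × ℝ × ℝ ↦ ‖q.1‖) (not_lt.1 h5)]
  by_cases h6 : ‖q.1‖ < s6 ε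
  · rw [glueBy_of_lt (τ := fun q : ℂ × ℝ × ℝ ↦ ‖q.1‖) (by exact h6)]
    exact Or.inr (Or.inr (Or.inl (winU3_taxonomy hε hε2 hq (not_lt.1 h5) h6)))
  rw [glueBy_of_le (τ := fun q : ℂ × ℝ × ℝ ↦ ‖q.1‖) (not_lt.1 h6)]
  by_cases h7 : ‖q.1‖ < s7 ε
  · rw [glueBy_of_lt (τ := fun q : ℂ × ℝ × ℝ ↦ ‖q.1‖) (by exact h7)]
    exact Or.inr (Or.inr (Or.inr (winU2_taxonomy hε hε2 hq (not_lt.1 h6) h7)))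
  · rw [glueBy_of_le (τ := fun q : ℂ × ℝ × ℝ ↦ ‖q.1‖) (not_lt.1 h7)]
    exact Or.inr (Or.inr (Or.inr (winU1_taxonomy hε hε2 hq (not_lt.1 h7) hr)))

end FP

end Literature.Topology.FourManifolds
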